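import Mathlib.Algebra.Order.Chebyshev
import Summits.AtomisticToContinuum.FouriersLaw.Theorems.OddSectorIrreversibilityTapLeakBoundBlockConeEnergy
import Summits.AtomisticToContinuum.FouriersLaw.Theorems.OddSectorIrreversibilityTapLeakBoundKickCone
import Summits.AtomisticToContinuum.FouriersLaw.Theorems.OddSectorIrreversibilityTapLeakBoundLocalMomentQ

/-!
# `TapLeakBound` (stmt-AtomisticToContinuum-15159), line `SketchIdeator2`, floor of `stub_kickCone`: local Gibbs moments

Helper file (`--supports stmt-AtomisticToContinuum-15159`) for crux
P = `Summit.AtomisticToContinuum.FouriersLaw.Theses.OddSectorIrreversibility.TapLeakBound`, registered stub `stub_kickCone`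
(C′ `ResampledKickCone`), floor sub-stub `stub_floorLocalMoments` (F3 of the floor program): **`N`-UNIFORM Gibbs moments of
every order of the two LOCAL observables of the block cone** of `pinnedChain ω₂ lam β γ` (`U = ω₂q²/2 + lam q⁴/4`,
`V = r²/2 + βr⁴/4`, `ω₂ > 0`, `lam, β ≥ 0`) under the unnormalised Gibbs weight `μ_T = e^{-H/T} dq dp` (`gibbsWeight`,
mass `Z = ∫ e^{-H/T}`): the SITE ENERGY `h_k = p_k²/2 + U(q_k) + ½V(q_{k+1} − q_k)[k+1<N] + ½V(q_k − q_{k−1})[0<k]` (the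
weighted energy of `…CorrectorTheorySiteEnergy.lean` with weight `[· = k]`, passed as the hypothesis `hX`) and the BOND
CURRENT `j_k = −½(p_k + p_{k+1})V'(q_{k+1} − q_k)` (`0` on the phantom bond): for every `m` there is
`C_m = C_m(ω₂, lam, β, γ, T) ≥ 0` with `∫ h_k^m dμ_T ≤ C_m Z`, `∫ |j_k|^m dμ_T ≤ C_m Z` for ALL `N` and all sites `k`.

Route: the closed form of `h_k` (`siteEnergy_eq_closed`) and the POINTWISE dominations `h_k ≤ (3 + ω₂ + lam + 2β) G`,
`|j_k| ≤ (3 + 6β) G` (`onsite_bonds_le_majorant`, `halfSum_mul_cubic_le_majorant`; `t² ≤ 1 + t⁴`,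
`(a − b)⁴ ≤ 8(a⁴ + b⁴)`, Young `ab³ ≤ a⁴/4 + 3b⁴/4`) by the quartic majorant `G = 1 + p_i⁴ + p_j⁴ + q_i⁴ + q_j⁴ + q_l⁴`
on at most three sites; the power mean `G^m ≤ 6^m(1 + p_i^{4m} + ⋯)` (`add_six_pow_le`, `pow_sum_le_card_mul_sum_pow`);
the landed `N`-UNIFORM single-coordinate even moments `∫ q_i^{4m} dμ_T, ∫ p_i^{4m} dμ_T ≤ C Z`
(`SubBallisticWindow.GibbsMoments.stub_gibbsMoments` fed with `…GibbsPoincare.stub_gibbsPoincare`) give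
`∫ G^m dμ_T ≤ 6^m (1 + 5C) Z` (`integral_majorant_pow_le`); domination (`integral_pow_le_of_le_mul`) finishes
(`localMoments_core`, `stub_floorLocalMoments`).
References: folklore (polynomial domination + Gibbs moments). Nothing here closes the item.
-/

noncomputable section

open MeasureTheory ProbabilityTheory Filter Topology Set Function
open scoped NNReal ENNReal

namespace Summit.AtomisticToContinuum.FouriersLaw.Theorems.OddSectorIrreversibility.TapLeak

open Literature.MathematicalPhysics.KineticTheory.HeatConduction
open Literature.MathematicalPhysics.KineticTheory
open Summit.AtomisticToContinuum.FouriersLaw.Theorems.OddSectorWitness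
open Summit.AtomisticToContinuum.FouriersLaw.Theorems.OddSectorIrreversibility.Corrector
open Summit.AtomisticToContinuum.FouriersLaw.Theorems.SubBallisticWindow

variable {N : ℕ}

/-! ### Elementary real inequalities -/

/-- Power mean for six nonnegative reals: `(a + b + c + d + e + f)^m ≤ 6^m (a^m + b^m + c^m + d^m + e^m + f^m)`
(Jensen, `pow_sum_le_card_mul_sum_pow`; the constant `6^{m-1}` is rounded up). [folklore] -/
theorem add_six_pow_le (m : ℕ) {a b c d e f : ℝ} (ha : 0 ≤ a) (hb : 0 ≤ b) (hc : 0 ≤ c) (hd : 0 ≤ d)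
    (he : 0 ≤ e) (hf : 0 ≤ f) :
    (a + b + c + d + e + f) ^ m ≤ 6 ^ m * (a ^ m + b ^ m + c ^ m + d ^ m + e ^ m + f ^ m) := by
  rcases Nat.eq_zero_or_pos m with rfl | hm
  · norm_num
  obtain ⟨n, rfl⟩ : ∃ n, m = n + 1 := ⟨m - 1, by omega⟩
  have h := pow_sum_le_card_mul_sum_pow (s := (Finset.univ : Finset (Fin 6)))
    (f := fun i => |(![a, b, c, d, e, f] : Fin 6 → ℝ) i|) (fun i _ => abs_nonneg _) n
  simp only [Fin.sum_univ_succ, Fin.sum_univ_zero, Matrix.cons_val_zero, Matrix.cons_val_succ, add_zero,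
    Finset.card_univ, Fintype.card_fin, abs_of_nonneg ha, abs_of_nonneg hb, abs_of_nonneg hc, abs_of_nonneg hd,
    abs_of_nonneg he, abs_of_nonneg hf] at h
  push_cast at h
  have hS : 0 ≤ a ^ (n + 1) + b ^ (n + 1) + c ^ (n + 1) + d ^ (n + 1) + e ^ (n + 1) + f ^ (n + 1) := by positivity
  have e1 : a + (b + (c + (d + (e + f)))) = a + b + c + d + e + f := by ring
  have e2 : a ^ (n + 1) + (b ^ (n + 1) + (c ^ (n + 1) + (d ^ (n + 1) + (e ^ (n + 1) + f ^ (n + 1))))) =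
      a ^ (n + 1) + b ^ (n + 1) + c ^ (n + 1) + d ^ (n + 1) + e ^ (n + 1) + f ^ (n + 1) := by ring
  rw [e1, e2] at h
  exact h.trans (mul_le_mul_of_nonneg_right (pow_le_pow_right₀ (by norm_num) (Nat.le_succ n)) hS)

/-- Young: `a b³ ≤ a⁴/4 + 3b⁴/4` for all reals (`a⁴ + 3b⁴ − 4ab³ = (a − b)²((a + b)² + 2b²)`). [folklore] -/
theorem mul_pow_three_le_quarter (a b : ℝ) : a * b ^ 3 ≤ a ^ 4 / 4 + 3 * b ^ 4 / 4 := by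
  nlinarith [mul_nonneg (sq_nonneg (a - b)) (add_nonneg (sq_nonneg (a + b)) (mul_nonneg zero_le_two (sq_nonneg b)))]

/-- `|p (r + β r³)| ≤ (p² + r²)/2 + β (p⁴ + 3r⁴)/4` for `β ≥ 0`. [folklore] -/
theorem abs_mul_cubic_le {β : ℝ} (hβ : 0 ≤ β) (p r : ℝ) :
    |p * (r + β * r ^ 3)| ≤ (p ^ 2 + r ^ 2) / 2 + β * (p ^ 4 + 3 * r ^ 4) / 4 := by
  have h2 : -(p * r ^ 3) ≤ (p ^ 4 + 3 * r ^ 4) / 4 := by nlinarith [mul_pow_three_le_quarter (-p) r]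
  have h2' : p * r ^ 3 ≤ (p ^ 4 + 3 * r ^ 4) / 4 := by nlinarith [mul_pow_three_le_quarter p r]
  rw [abs_le]
  constructor
  · nlinarith [sq_nonneg (p + r), mul_le_mul_of_nonneg_left h2 hβ]
  · nlinarith [sq_nonneg (p - r), mul_le_mul_of_nonneg_left h2' hβ]

/-! ### The site energy: closed form and the neighbouring sites -/

section SiteEnergy

variable (P : OscillatorChain) (k : Fin N) (X : PhaseSpace N → ℝ)
  (hX : X = fun x => (∑ k' : Fin N, (if k' = k then (1 : ℝ) else 0) * (x.2 k' ^ 2 / 2 + P.U (x.1 k'))) +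
    ∑ k' : Fin N, ∑ l : Fin N,
      if l.val = k'.val + 1 then ((if k' = k then (1 : ℝ) else 0) + (if l = k then (1 : ℝ) else 0)) / 2 *
        P.V (x.1 l - x.1 k') else 0)
include hX

/-- **Closed form of the site energy**:
`h_k = p_k²/2 + U(q_k) + ½V(q_{k+1} − q_k)[k+1<N] + ½V(q_k − q_{k−1})[0<k]`. [folklore] -/
theorem siteEnergy_eq_closed (x : PhaseSpace N) :
    X x = x.2 k ^ 2 / 2 + P.U (x.1 k) +
      ((if h : k.val + 1 < N then P.V (x.1 ⟨k.val + 1, h⟩ - x.1 k) / 2 else 0) +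
        (if h : 0 < k.val then P.V (x.1 k - x.1 ⟨k.val - 1, by omega⟩) / 2 else 0)) := by
  subst hX
  have h1 : ∑ k' : Fin N, (if k' = k then (1 : ℝ) else 0) * (x.2 k' ^ 2 / 2 + P.U (x.1 k')) =
      x.2 k ^ 2 / 2 + P.U (x.1 k) := by
    rw [Finset.sum_eq_single_of_mem k (Finset.mem_univ _) fun k' _ hk' => by rw [if_neg hk', zero_mul]]
    rw [if_pos rfl, one_mul]
  have hout : ∑ k' : Fin N, ∑ l : Fin N, (if k' = k then
      (if l.val = k'.val + 1 then P.V (x.1 l - x.1 k') / 2 else 0) else 0) =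
      if h : k.val + 1 < N then P.V (x.1 ⟨k.val + 1, h⟩ - x.1 k) / 2 else 0 := by
    rw [Finset.sum_eq_single_of_mem k (Finset.mem_univ _) fun k' _ hk' =>
      Finset.sum_eq_zero fun l _ => if_neg hk']
    simp only [if_true]
    exact sum_ite_eq_succ (fun l => P.V (x.1 l - x.1 k) / 2) k
  have hin : ∑ k' : Fin N, ∑ l : Fin N, (if l = k then
      (if l.val = k'.val + 1 then P.V (x.1 l - x.1 k') / 2 else 0) else 0) =
      if h : 0 < k.val then P.V (x.1 k - x.1 ⟨k.val - 1, by omega⟩) / 2 else 0 := by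
    rw [Finset.sum_comm, Finset.sum_eq_single_of_mem k (Finset.mem_univ _) fun l _ hl =>
      Finset.sum_eq_zero fun k' _ => if_neg hl]
    simp only [if_true]
    exact sum_ite_eq_pred (fun k' => P.V (x.1 k - x.1 k') / 2) k
  have e1 : ∀ k' l : Fin N, (if l.val = k'.val + 1 then
      ((if k' = k then (1 : ℝ) else 0) + (if l = k then (1 : ℝ) else 0)) / 2 * P.V (x.1 l - x.1 k') else 0) =
      (if k' = k then (if l.val = k'.val + 1 then P.V (x.1 l - x.1 k') / 2 else 0) else 0) +
        (if l = k then (if l.val = k'.val + 1 then P.V (x.1 l - x.1 k') / 2 else 0) else 0) := by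
    intro k' l
    split_ifs <;> ring
  simp only [e1, Finset.sum_add_distrib, h1, hout, hin]

/-- Two sites `j₁, j₂` (the neighbours of `k` when they exist, else `k` itself) with
`h_k ≤ p_k²/2 + U(q_k) + ½V(q_{j₂} − q_k) + ½V(q_k − q_{j₁})` everywhere (`V ≥ 0`). [folklore] -/
theorem siteEnergy_le_neighbours (hV0 : ∀ r, 0 ≤ P.V r) :
    ∃ j₁ j₂ : Fin N, ∀ x : PhaseSpace N,
      X x ≤ x.2 k ^ 2 / 2 + P.U (x.1 k) + (P.V (x.1 j₂ - x.1 k) / 2 + P.V (x.1 k - x.1 j₁) / 2) := by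
  obtain ⟨j₂, hj₂⟩ : ∃ j : Fin N, ∀ x : PhaseSpace N,
      (if h : k.val + 1 < N then P.V (x.1 ⟨k.val + 1, h⟩ - x.1 k) / 2 else 0) ≤ P.V (x.1 j - x.1 k) / 2 := by
    by_cases h : k.val + 1 < N
    · exact ⟨⟨k.val + 1, h⟩, fun x => by rw [dif_pos h]⟩
    · exact ⟨k, fun x => by rw [dif_neg h]; linarith [hV0 (x.1 k - x.1 k)]⟩
  obtain ⟨j₁, hj₁⟩ : ∃ j : Fin N, ∀ x : PhaseSpace N,
      (if h : 0 < k.val then P.V (x.1 k - x.1 ⟨k.val - 1, by omega⟩) / 2 else 0) ≤ P.V (x.1 k - x.1 j) / 2 := by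
    by_cases h : 0 < k.val
    · exact ⟨⟨k.val - 1, by omega⟩, fun x => by rw [dif_pos h]⟩
    · exact ⟨k, fun x => by rw [dif_neg h]; linarith [hV0 (x.1 k - x.1 k)]⟩
  refine ⟨j₁, j₂, fun x => ?_⟩
  rw [siteEnergy_eq_closed P k X hX x]
  linarith [hj₁ x, hj₂ x]

end SiteEnergy

/-! ### Quartic majorants for the pinned chain -/

section Pinned

variable {ω₂ lam β : ℝ} (hω : 0 ≤ ω₂) (hl : 0 ≤ lam) (hβ : 0 ≤ β)
include hω hl hβ

/-- The on-site energy plus two half bonds is dominated by the quartic majorant: for any `e ≥ 0`,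
`p²/2 + U(b) + ½V(d − b) + ½V(b − c) ≤ (3 + ω₂ + lam + 2β)(1 + p⁴ + e + b⁴ + c⁴ + d⁴)`. [folklore] -/
theorem onsite_bonds_le_majorant (p b c d e : ℝ) (he : 0 ≤ e) :
    p ^ 2 / 2 + (pinnedChain ω₂ lam β 0).U b +
        ((pinnedChain ω₂ lam β 0).V (d - b) / 2 + (pinnedChain ω₂ lam β 0).V (b - c) / 2) ≤
      (3 + ω₂ + lam + 2 * β) * (1 + p ^ 4 + e + b ^ 4 + c ^ 4 + d ^ 4) := by
  have hU : (pinnedChain ω₂ lam β 0).U b = ω₂ * b ^ 2 / 2 + lam * b ^ 4 / 4 := rfl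
  have hV : ∀ r, (pinnedChain ω₂ lam β 0).V r = r ^ 2 / 2 + β * r ^ 4 / 4 := fun r => rfl
  rw [hU, hV, hV]
  -- `t² ≤ 1 + t⁴` and `(a − b)⁴ ≤ 8(a⁴ + b⁴)`
  have hsq : ∀ t : ℝ, t ^ 2 ≤ 1 + t ^ 4 := fun t => by nlinarith [sq_nonneg (t ^ 2 - 1), sq_nonneg t]
  have hr4 : ∀ a a' : ℝ, (a - a') ^ 4 ≤ 8 * (a ^ 4 + a' ^ 4) := fun a a' => by
    have h2 : (a - a') ^ 2 ≤ 2 * (a ^ 2 + a' ^ 2) := by nlinarith [sq_nonneg (a + a')]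
    nlinarith [sq_nonneg (a ^ 2 - a' ^ 2), pow_le_pow_left₀ (sq_nonneg _) h2 2]
  have hp := hsq p
  have hb := hsq b
  have hc := hsq c
  have hd := hsq d
  have h1 : (d - b) ^ 2 ≤ 2 * (d ^ 2 + b ^ 2) := by nlinarith [sq_nonneg (d + b)]
  have h2 : (b - c) ^ 2 ≤ 2 * (b ^ 2 + c ^ 2) := by nlinarith [sq_nonneg (b + c)]
  have h3 := mul_le_mul_of_nonneg_left (hr4 d b) hβ
  have h4 := mul_le_mul_of_nonneg_left (hr4 b c) hβ
  have h5 := mul_le_mul_of_nonneg_left hb hω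
  have hp4 : 0 ≤ p ^ 4 := by positivity
  have hb4 : 0 ≤ b ^ 4 := by positivity
  have hc4 : 0 ≤ c ^ 4 := by positivity
  have hd4 : 0 ≤ d ^ 4 := by positivity
  linarith [mul_nonneg hω hp4, mul_nonneg hl hp4, mul_nonneg hβ hp4, mul_nonneg hω he, mul_nonneg hl he,
    mul_nonneg hβ he, mul_nonneg hω hb4, mul_nonneg hl hb4, mul_nonneg hβ hb4, mul_nonneg hω hc4,
    mul_nonneg hl hc4, mul_nonneg hβ hc4, mul_nonneg hω hd4, mul_nonneg hl hd4, mul_nonneg hβ hd4]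

omit hω hl in
/-- The bond-current polynomial is dominated by the quartic majorant: for any `e ≥ 0` and `r = d − b`,
`|½(p + p')(r + βr³)| ≤ (3 + 6β)(1 + p⁴ + p'⁴ + b⁴ + d⁴ + e)`. [folklore] -/
theorem halfSum_mul_cubic_le_majorant (p p' b d e : ℝ) (he : 0 ≤ e) :
    |(p + p') / 2 * ((d - b) + β * (d - b) ^ 3)| ≤ (3 + 6 * β) * (1 + p ^ 4 + p' ^ 4 + b ^ 4 + d ^ 4 + e) := by
  have h0 := abs_mul_cubic_le hβ ((p + p') / 2) (d - b)
  have hA2 : ((p + p') / 2) ^ 2 ≤ (p ^ 2 + p' ^ 2) / 2 := by nlinarith [sq_nonneg (p - p')]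
  have hA4 : ((p + p') / 2) ^ 4 ≤ (p ^ 4 + p' ^ 4) / 2 := by
    have h := pow_le_pow_left₀ (sq_nonneg ((p + p') / 2)) hA2 2
    nlinarith [sq_nonneg (p ^ 2 - p' ^ 2), h]
  have hr2 : (d - b) ^ 2 ≤ 2 * (d ^ 2 + b ^ 2) := by nlinarith [sq_nonneg (d + b)]
  have hr4 : (d - b) ^ 4 ≤ 8 * (d ^ 4 + b ^ 4) := by
    nlinarith [sq_nonneg (d ^ 2 - b ^ 2), pow_le_pow_left₀ (sq_nonneg _) hr2 2]
  have hsq : ∀ t : ℝ, t ^ 2 ≤ 1 + t ^ 4 := fun t => by nlinarith [sq_nonneg (t ^ 2 - 1), sq_nonneg t]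
  have hp := hsq p
  have hp' := hsq p'
  have hb := hsq b
  have hd := hsq d
  have h3 := mul_le_mul_of_nonneg_left hA4 hβ
  have h4 := mul_le_mul_of_nonneg_left hr4 hβ
  have hp4 : 0 ≤ p ^ 4 := by positivity
  have hp4' : 0 ≤ p' ^ 4 := by positivity
  have hb4 : 0 ≤ b ^ 4 := by positivity
  have hd4 : 0 ≤ d ^ 4 := by positivity
  linarith [mul_nonneg hβ hp4, mul_nonneg hβ hp4', mul_nonneg hβ hb4, mul_nonneg hβ hd4, mul_nonneg hβ he]

omit hω hl hβ in
/-- A site `j` (the right neighbour of `k` if it exists, else `k`) with `|j_k| ≤ |½(p_k + p_j)(r + βr³)|`,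
`r = q_j − q_k`, everywhere (`j_k = 0` on the phantom bond; `V'(r) = r + βr³`). [folklore] -/
theorem exists_abs_bondCurrent_le (γ : ℝ) (k : Fin N) :
    ∃ j : Fin N, ∀ x : PhaseSpace N, |(pinnedChain ω₂ lam β γ).bondCurrent N k x| ≤
      |(x.2 k + x.2 j) / 2 * ((x.1 j - x.1 k) + β * (x.1 j - x.1 k) ^ 3)| := by
  by_cases h : k.val + 1 < N
  · refine ⟨⟨k.val + 1, h⟩, fun x => ?_⟩
    rw [LightConeBondHeat.bondCurrent_eq_of_lt _ h x, pinnedChain_deriv_V, abs_neg]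
  · refine ⟨k, fun x => ?_⟩
    have hz : (pinnedChain ω₂ lam β γ).bondCurrent N k x = 0 :=
      Finset.sum_eq_zero fun j _ => if_neg fun hv : j.val = k.val + 1 => h (hv ▸ j.isLt)
    rw [hz, abs_zero]; exact abs_nonneg _

end Pinned

/-! ### Gibbs integrals: domination and the moments of the majorant -/

/-- Domination: `0 ≤ f ≤ K g` pointwise and `g^m ∈ L¹(μ)` ⇒ `f^m ∈ L¹(μ)` and `∫ f^m dμ ≤ K^m ∫ g^m dμ`. [folklore] -/
theorem integral_pow_le_of_le_mul {α : Type*} [MeasurableSpace α] {μ : Measure α} {f g : α → ℝ} {K : ℝ} (m : ℕ)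
    (hf : AEStronglyMeasurable f μ) (h0 : ∀ x, 0 ≤ f x) (hle : ∀ x, f x ≤ K * g x)
    (hg : Integrable (fun x => g x ^ m) μ) :
    Integrable (fun x => f x ^ m) μ ∧ ∫ x, f x ^ m ∂μ ≤ K ^ m * ∫ x, g x ^ m ∂μ := by
  have hpt : ∀ x, f x ^ m ≤ K ^ m * g x ^ m := fun x => by rw [← mul_pow]; exact pow_le_pow_left₀ (h0 x) (hle x) m
  have hKg : Integrable (fun x => K ^ m * g x ^ m) μ := hg.const_mul (K ^ m)
  have hI : Integrable (fun x => f x ^ m) μ :=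
    hKg.mono' (hf.pow m) (Eventually.of_forall fun x => by
      rw [Real.norm_eq_abs, abs_of_nonneg (pow_nonneg (h0 x) m)]
      exact hpt x)
  exact ⟨hI, (integral_mono hI hKg hpt).trans_eq (integral_const_mul _ _)⟩

section Core

variable {ω₂ lam β : ℝ} (hω : 0 < ω₂) (hl : 0 ≤ lam) (hβ : 0 ≤ β) (γ : ℝ) {T : ℝ} (hT : 0 < T)
include hω hl hβ hT

/-- **Moments of the quartic majorant.** If `∫ q_i^{4m} dμ_T ≤ C Z` and `∫ p_i^{4m} dμ_T ≤ C Z` at all sites `i`, then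
`G = 1 + p_i⁴ + p_j⁴ + q_i⁴ + q_j⁴ + q_l⁴` has `G^m ∈ L¹(μ_T)` and `∫ G^m dμ_T ≤ 6^m (1 + 5C) Z`
(power mean, `∫ 1 dμ_T = Z`, every monomial is `μ_T`-integrable). [folklore] -/
theorem integral_majorant_pow_le (m : ℕ) {C : ℝ}
    (hq : ∀ i : Fin N, ∫ x, (x.1 i) ^ (2 * (2 * m)) ∂(gibbsWeight ω₂ lam β γ N T) ≤
      C * ∫ x, Real.exp (-((pinnedChain ω₂ lam β γ).hamiltonian N x) / T) ∂volume)
    (hp : ∀ i : Fin N, ∫ x, (x.2 i) ^ (2 * (2 * m)) ∂(gibbsWeight ω₂ lam β γ N T) ≤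
      C * ∫ x, Real.exp (-((pinnedChain ω₂ lam β γ).hamiltonian N x) / T) ∂volume)
    (i j l : Fin N) :
    Integrable (fun x : PhaseSpace N => (1 + x.2 i ^ 4 + x.2 j ^ 4 + x.1 i ^ 4 + x.1 j ^ 4 + x.1 l ^ 4) ^ m)
        (gibbsWeight ω₂ lam β γ N T) ∧
      ∫ x, (1 + x.2 i ^ 4 + x.2 j ^ 4 + x.1 i ^ 4 + x.1 j ^ 4 + x.1 l ^ 4) ^ m ∂(gibbsWeight ω₂ lam β γ N T) ≤
        6 ^ m * (1 + 5 * C) * ∫ x, Real.exp (-((pinnedChain ω₂ lam β γ).hamiltonian N x) / T) ∂volume := by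
  haveI : IsFiniteMeasure (gibbsWeight ω₂ lam β γ N T) := isFiniteMeasure_gibbsWeight hω hl hβ γ N hT
  have hZ1 : ∫ _x, (1 : ℝ) ∂(gibbsWeight ω₂ lam β γ N T) =
      ∫ x, Real.exp (-((pinnedChain ω₂ lam β γ).hamiltonian N x) / T) ∂volume := by
    rw [integral_gibbsWeight]
    simp only [mul_one]
  -- integrability of the monomials and of the constant
  have hP : ∀ k : Fin N, Integrable (fun x : PhaseSpace N => x.2 k ^ (2 * (2 * m))) (gibbsWeight ω₂ lam β γ N T) :=
    fun k => GibbsMoments.integrable_pow_gibbs γ N hω hl hβ hT rfl ((continuous_apply k).comp continuous_snd)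
      (GibbsMoments.abs_momentum_le hω.le hl hβ γ N · k) (2 * (2 * m))
  have hQ : ∀ k : Fin N, Integrable (fun x : PhaseSpace N => x.1 k ^ (2 * (2 * m))) (gibbsWeight ω₂ lam β γ N T) :=
    fun k => GibbsMoments.integrable_pow_gibbs γ N hω hl hβ hT rfl ((continuous_apply k).comp continuous_fst)
      (GibbsMoments.abs_position_le hω hl hβ γ N · k) (2 * (2 * m))
  set μ := gibbsWeight ω₂ lam β γ N T with hμ
  set Z := ∫ x, Real.exp (-((pinnedChain ω₂ lam β γ).hamiltonian N x) / T) ∂volume with hZ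
  set n := 2 * (2 * m) with hn
  have e4 : ∀ t : ℝ, (t ^ 4) ^ m = t ^ n := fun t => by rw [← pow_mul, hn, show 4 * m = 2 * (2 * m) by ring]
  have h1 : Integrable (fun _ : PhaseSpace N => (1 : ℝ)) μ := integrable_const 1
  have hS1 : Integrable (fun x : PhaseSpace N => 1 + x.2 i ^ n) μ := h1.add (hP i)
  have hS2 : Integrable (fun x : PhaseSpace N => 1 + x.2 i ^ n + x.2 j ^ n) μ := hS1.add (hP j)
  have hS3 : Integrable (fun x : PhaseSpace N => 1 + x.2 i ^ n + x.2 j ^ n + x.1 i ^ n) μ := hS2.add (hQ i)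
  have hS4 : Integrable (fun x : PhaseSpace N => 1 + x.2 i ^ n + x.2 j ^ n + x.1 i ^ n + x.1 j ^ n) μ :=
    hS3.add (hQ j)
  have hS5 : Integrable (fun x : PhaseSpace N => 1 + x.2 i ^ n + x.2 j ^ n + x.1 i ^ n + x.1 j ^ n + x.1 l ^ n) μ :=
    hS4.add (hQ l)
  have hR := hS5.const_mul ((6 : ℝ) ^ m)
  -- pointwise power mean, integrability of `G^m` by domination
  have hpt : ∀ x : PhaseSpace N, (1 + x.2 i ^ 4 + x.2 j ^ 4 + x.1 i ^ 4 + x.1 j ^ 4 + x.1 l ^ 4) ^ m ≤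
      6 ^ m * (1 + x.2 i ^ n + x.2 j ^ n + x.1 i ^ n + x.1 j ^ n + x.1 l ^ n) := fun x => by
    have h := add_six_pow_le m zero_le_one (by positivity : (0 : ℝ) ≤ x.2 i ^ 4)
      (by positivity : (0 : ℝ) ≤ x.2 j ^ 4) (by positivity : (0 : ℝ) ≤ x.1 i ^ 4)
      (by positivity : (0 : ℝ) ≤ x.1 j ^ 4) (by positivity : (0 : ℝ) ≤ x.1 l ^ 4)
    simpa only [one_pow, e4] using h
  have hGc : Continuous fun x : PhaseSpace N => (1 + x.2 i ^ 4 + x.2 j ^ 4 + x.1 i ^ 4 + x.1 j ^ 4 + x.1 l ^ 4) ^ m := by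
    fun_prop
  have hGI : Integrable (fun x : PhaseSpace N => (1 + x.2 i ^ 4 + x.2 j ^ 4 + x.1 i ^ 4 + x.1 j ^ 4 + x.1 l ^ 4) ^ m) μ :=
    hR.mono' hGc.aestronglyMeasurable (Eventually.of_forall fun x => by
      rw [Real.norm_eq_abs, abs_of_nonneg (by positivity)]
      exact hpt x)
  refine ⟨hGI, ?_⟩
  calc ∫ x, (1 + x.2 i ^ 4 + x.2 j ^ 4 + x.1 i ^ 4 + x.1 j ^ 4 + x.1 l ^ 4) ^ m ∂μ
      ≤ ∫ x, 6 ^ m * (1 + x.2 i ^ n + x.2 j ^ n + x.1 i ^ n + x.1 j ^ n + x.1 l ^ n) ∂μ := integral_mono hGI hR hpt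
    _ = 6 ^ m * ((∫ _x, (1 : ℝ) ∂μ) + (∫ x, x.2 i ^ n ∂μ) + (∫ x, x.2 j ^ n ∂μ) + (∫ x, x.1 i ^ n ∂μ) +
          (∫ x, x.1 j ^ n ∂μ) + ∫ x, x.1 l ^ n ∂μ) := by
        rw [integral_const_mul, integral_add hS4 (hQ l), integral_add hS3 (hQ j), integral_add hS2 (hQ i),
          integral_add hS1 (hP j), integral_add h1 (hP i)]
    _ ≤ 6 ^ m * (Z + C * Z + C * Z + C * Z + C * Z + C * Z) := by
        rw [hZ1]
        gcongr
        exacts [hp i, hp j, hq i, hq j, hq l]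
    _ = 6 ^ m * (1 + 5 * C) * Z := by ring

/-- **Core estimate at fixed `N`.** Given the `4m`-th single-coordinate moments `≤ C Z` at all sites, the site energy `h_k`
(hypothesis `hX`) and the bond current `j_k` have `h_k^m, |j_k|^m ∈ L¹(μ_T)` with integrals
`≤ (3 + ω₂ + lam + 6β)^m 6^m (1 + 5C) Z` (`0 ≤ h_k ≤ (3 + ω₂ + lam + 2β) G`, `|j_k| ≤ (3 + 6β) G'` for quartic
majorants `G, G'` on the sites `k, k ± 1`, then `integral_majorant_pow_le` and domination). [folklore] -/
theorem localMoments_core (m : ℕ) {C : ℝ}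
    (hq : ∀ i : Fin N, ∫ x, (x.1 i) ^ (2 * (2 * m)) ∂(gibbsWeight ω₂ lam β γ N T) ≤
      C * ∫ x, Real.exp (-((pinnedChain ω₂ lam β γ).hamiltonian N x) / T) ∂volume)
    (hp : ∀ i : Fin N, ∫ x, (x.2 i) ^ (2 * (2 * m)) ∂(gibbsWeight ω₂ lam β γ N T) ≤
      C * ∫ x, Real.exp (-((pinnedChain ω₂ lam β γ).hamiltonian N x) / T) ∂volume)
    (k : Fin N) (X : PhaseSpace N → ℝ)
    (hX : X = fun x => (∑ k' : Fin N, (if k' = k then (1 : ℝ) else 0) *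
        (x.2 k' ^ 2 / 2 + (pinnedChain ω₂ lam β 0).U (x.1 k'))) +
      ∑ k' : Fin N, ∑ l : Fin N,
        if l.val = k'.val + 1 then ((if k' = k then (1 : ℝ) else 0) + (if l = k then (1 : ℝ) else 0)) / 2 *
          (pinnedChain ω₂ lam β 0).V (x.1 l - x.1 k') else 0) :
    (Integrable (fun x => X x ^ m) (gibbsWeight ω₂ lam β γ N T) ∧
      ∫ x, X x ^ m ∂(gibbsWeight ω₂ lam β γ N T) ≤
        (3 + ω₂ + lam + 6 * β) ^ m * (6 ^ m * (1 + 5 * C)) *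
          ∫ x, Real.exp (-((pinnedChain ω₂ lam β γ).hamiltonian N x) / T) ∂volume) ∧
    Integrable (fun x => |(pinnedChain ω₂ lam β γ).bondCurrent N k x| ^ m) (gibbsWeight ω₂ lam β γ N T) ∧
      ∫ x, |(pinnedChain ω₂ lam β γ).bondCurrent N k x| ^ m ∂(gibbsWeight ω₂ lam β γ N T) ≤
        (3 + ω₂ + lam + 6 * β) ^ m * (6 ^ m * (1 + 5 * C)) *
          ∫ x, Real.exp (-((pinnedChain ω₂ lam β γ).hamiltonian N x) / T) ∂volume := by
  have hU0 : ∀ q, 0 ≤ (pinnedChain ω₂ lam β 0).U q := fun q => by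
    show 0 ≤ ω₂ * q ^ 2 / 2 + lam * q ^ 4 / 4; positivity
  have hV0 : ∀ r, 0 ≤ (pinnedChain ω₂ lam β 0).V r := fun r => by
    show 0 ≤ r ^ 2 / 2 + β * r ^ 4 / 4; positivity
  -- domination by a quartic majorant on three sites with a constant `K ≤ 3 + ω₂ + lam + 6β`
  have hfin : ∀ {f : PhaseSpace N → ℝ} {K : ℝ} (i j l : Fin N), Continuous f → (∀ x, 0 ≤ f x) →
      K ≤ 3 + ω₂ + lam + 6 * β → (∀ x, f x ≤ K * (1 + x.2 i ^ 4 + x.2 j ^ 4 + x.1 i ^ 4 + x.1 j ^ 4 + x.1 l ^ 4)) →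
      Integrable (fun x => f x ^ m) (gibbsWeight ω₂ lam β γ N T) ∧
        ∫ x, f x ^ m ∂(gibbsWeight ω₂ lam β γ N T) ≤ (3 + ω₂ + lam + 6 * β) ^ m * (6 ^ m * (1 + 5 * C)) *
          ∫ x, Real.exp (-((pinnedChain ω₂ lam β γ).hamiltonian N x) / T) ∂volume := by
    intro f K i j l hfc hf0 hK hdom
    obtain ⟨hGI, hGle⟩ := integral_majorant_pow_le hω hl hβ γ hT m hq hp i j l
    have hdom' : ∀ x : PhaseSpace N, f x ≤ (3 + ω₂ + lam + 6 * β) *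
        (1 + x.2 i ^ 4 + x.2 j ^ 4 + x.1 i ^ 4 + x.1 j ^ 4 + x.1 l ^ 4) := fun x =>
      (hdom x).trans (mul_le_mul_of_nonneg_right hK (by positivity))
    obtain ⟨hI, hIle⟩ := integral_pow_le_of_le_mul m hfc.aestronglyMeasurable hf0 hdom' hGI
    refine ⟨hI, hIle.trans ?_⟩
    rw [mul_assoc]
    exact mul_le_mul_of_nonneg_left hGle (by positivity)
  refine ⟨?_, ?_⟩
  · obtain ⟨j₁, j₂, hle⟩ := siteEnergy_le_neighbours (pinnedChain ω₂ lam β 0) k X hX hV0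
    exact hfin k j₁ j₂ (contDiff_siteEnergy k X hX).continuous
      (siteEnergy_nonneg (pinnedChain ω₂ lam β 0) k X hX hU0 hV0) (by linarith) fun x =>
        (hle x).trans (onsite_bonds_le_majorant hω.le hl hβ (x.2 k) (x.1 k) (x.1 j₁) (x.1 j₂) (x.2 j₁ ^ 4)
          (by positivity))
  · obtain ⟨j, hj⟩ := exists_abs_bondCurrent_le (ω₂ := ω₂) (lam := lam) (β := β) (N := N) γ k
    exact hfin k j j (pinnedChain_continuous_bondCurrent ω₂ lam β γ N k).abs (fun x => abs_nonneg _)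
      (by linarith) fun x =>
        (hj x).trans (halfSum_mul_cubic_le_majorant hβ (x.2 k) (x.2 j) (x.1 k) (x.1 j) (x.1 j ^ 4) (by positivity))

end Core

/-! ### Registered sub-goal of the line -/

/-- **Sub-goal `stub_floorLocalMoments`** (registered on the crux item for this helper file; F3 of the floor program of
`stub_kickCone`): `N`-UNIFORM Gibbs moments of every order of the site energy `h_k` (the double sum `X` is the
weighted energy with weight `[· = k]`) and of the bond current `|j_k|` under the unnormalised Gibbs weight `μ_T`:
`∫ h_k^m dμ_T ≤ C Z` and `∫ |j_k|^m dμ_T ≤ C Z` with `C = C(ω₂, lam, β, γ, T, m) ≥ 0` independent of `N` and `k`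
(here `C = (3 + ω₂ + lam + 6β)^m 6^m (1 + 5 max(C_{2m}, 0))`, `C_{2m}` the `N`-uniform `4m`-th single-coordinate
moment constant of `SubBallisticWindow.GibbsMoments.stub_gibbsMoments` fed with `…GibbsPoincare.stub_gibbsPoincare`).
[folklore] -/
theorem stub_floorLocalMoments : ∀ (ω₂ lam β γ : ℝ), 0 < ω₂ → 0 ≤ lam → 0 ≤ β → ∀ (T : ℝ), 0 < T → ∀ (m : ℕ), ∃ C : ℝ, 0 ≤ C ∧ ∀ (N : ℕ) (k : Fin N), (∀ (X : PhaseSpace N → ℝ), X = (fun x => (∑ k' : Fin N, (if k' = k then (1 : ℝ) else 0) * (x.2 k' ^ 2 / 2 + (pinnedChain ω₂ lam β 0).U (x.1 k'))) + ∑ k' : Fin N, ∑ l : Fin N, if l.val = k'.val + 1 then ((if k' = k then (1 : ℝ) else 0) + (if l = k then (1 : ℝ) else 0)) / 2 * (pinnedChain ω₂ lam β 0).V (x.1 l - x.1 k') else 0) → MeasureTheory.Integrable (fun x => X x ^ m) (gibbsWeight ω₂ lam β γ N T) ∧ ∫ x, X x ^ m ∂(gibbsWeight ω₂ lam β γ N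 T) ≤ C * ∫ x, Real.exp (-((pinnedChain ω₂ lam β γ).hamiltonian N x) / T) ∂MeasureTheory.volume) ∧ MeasureTheory.Integrable (fun x => |(pinnedChain ω₂ lam β γ).bondCurrent N k x| ^ m) (gibbsWeight ω₂ lam β γ N T) ∧ ∫ x, |(pinnedChain ω₂ lam β γ).bondCurrent N k x| ^ m ∂(gibbsWeight ω₂ lam β γ N T) ≤ C * ∫ x, Real.exp (-((pinnedChain ω₂ lam β γ).hamiltonian N x) / T) ∂MeasureTheory.volume := by
  intro ω₂ lam β γ hω hl hβ T hT m
  have hPI := GibbsPoincare.stub_gibbsPoincare ω₂ lam β γ hω hl hβ T hT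
  obtain ⟨C₀, hC₀⟩ := GibbsMoments.stub_gibbsMoments ω₂ lam β γ hω hl hβ T hT hPI (2 * m)
  refine ⟨(3 + ω₂ + lam + 6 * β) ^ m * (6 ^ m * (1 + 5 * max C₀ 0)), by positivity, fun N k => ?_⟩
  have hZ0 : 0 ≤ ∫ x : PhaseSpace N, Real.exp (-((pinnedChain ω₂ lam β γ).hamiltonian N x) / T) ∂volume :=
    integral_nonneg fun x => (Real.exp_pos _).le
  have hq : ∀ i : Fin N, ∫ x, (x.1 i) ^ (2 * (2 * m)) ∂(gibbsWeight ω₂ lam β γ N T) ≤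
      max C₀ 0 * ∫ x, Real.exp (-((pinnedChain ω₂ lam β γ).hamiltonian N x) / T) ∂volume := fun i =>
    (hC₀ N i).1.trans (mul_le_mul_of_nonneg_right (le_max_left _ _) hZ0)
  have hp : ∀ i : Fin N, ∫ x, (x.2 i) ^ (2 * (2 * m)) ∂(gibbsWeight ω₂ lam β γ N T) ≤
      max C₀ 0 * ∫ x, Real.exp (-((pinnedChain ω₂ lam β γ).hamiltonian N x) / T) ∂volume := fun i =>
    (hC₀ N i).2.trans (mul_le_mul_of_nonneg_right (le_max_left _ _) hZ0)
  exact ⟨fun X hX => (localMoments_core hω hl hβ γ hT m hq hp k X hX).1,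
    (localMoments_core hω hl hβ γ hT m hq hp k _ rfl).2⟩

end Summit.AtomisticToContinuum.FouriersLaw.Theorems.OddSectorIrreversibility.TapLeak

end
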